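import Summits.BirchSwinnertonDyer.BirchSwinnertonDyer.Theorems.CyclotomicUntwistPSRootNumberThree
import Summits.BirchSwinnertonDyer.BirchSwinnertonDyer.Theorems.CyclotomicUntwistFiniteSlopeValueAtOne
import Summits.BirchSwinnertonDyer.BirchSwinnertonDyer.Theorems.Rank2ObservatoryRootNumberLocal
import Literature.NumberTheory.EllipticCurves.BSDRootNumberModularityOnlyProofs
import Literature.NumberTheory.DiophantineGeometry.LocalReductionFiniteBadPlacesProofs
import HarnessLib

/-!
# Parity at the untwisting character (route `CyclotomicUntwist`): `η(−1) = W₃(E)` BY NAME, and the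
# rank-one parity reading `∏_{v ∤ 3} w_v(E) = W₃(E)` on the principal-series rows

Cell `pub/bsd-wall` (D-0145 line `route-BirchSwinnertonDyer-CyclotomicUntwist`), seat `bsd-line-cycu-p3`
(gen 5). Helper toward the cruxes K1 `PSRankOneLowerHalfAtThree` (stmt-BirchSwinnertonDyer-21580) and
K2 `PSRankOneUpperHalfAtThree` (stmt-21581). THEOREMS ONLY (no definition, no named fact, no `sorry`);
BSD is not proved by this file and no crux is. It closes the two items left open by LAW L-w3
(`PSRootNumberThree`, memo `Cruxes/PSRankOneLowerHalfAtThree/LAW-Lw3-KERNEL-v1.md` §successor (a), (b)).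

Notation: `W/ℚ` elliptic, globally minimal; `v := v₃(Δ_min)`; `W₃ := W.rootNumberThree` (Rizzo's
Table II value, `RootNumberTableThree`); `η : DirichletCharacter ℂ_[3] (3 ^ 2)` — the currency of the
route's definition D1 `Literature.NumberTheory.IwasawaTheory.PSCyclotomicLFunction`
(`IsPSCyclotomicLFunctionOf W η α 𝓛`), where the untwisting character `η` mod `9` and the root `α`
are FREE parameters and the matching "`η` restricted to inertia is the inertia character of `W` at
`3`" is context, not a hypothesis of the predicate. The one numerical invariant of that matching that
the tree can state today is the ORDER: `orderOf η = krausInertiaOrderThree W` (`= #Φ ∈ {3, 6}` on the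
principal-series rows, `WildThreeKrausCells`, `PSKodairaDictionary.krausInertiaOrderThree_of_even`).

## What is proved

* §1 (the character side, any `η` mod `9` with values in `ℂ₃`): `η(−1) = η(2)³`
  (`eta_neg_one_eq_pow_three`); `η ^ n = 1 ↔ η(2) ^ n = 1` and `orderOf η = orderOf η(2)`
  (a character mod `9` is determined by its value at the generator `2`); for `η` PRIMITIVE
  (conductor `9`): `η(2)³ = ±1`, **`orderOf η = 3 ∨ orderOf η = 6`**,
  **`η.Even ↔ orderOf η = 3`**, **`η.Odd ↔ orderOf η = 6`**, i.e.
  `η(−1) = if orderOf η = 6 then −1 else 1` (`eta_neg_one_eq_ite`).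
* §2 (the bridge, PS rows of K1/K2: `ClassO6 W 3`, `v` even, `Δ_min/3^v ≡ 1 (mod 3)`): for `η`
  primitive with `orderOf η = krausInertiaOrderThree W`:
  **`eta_neg_one_eq_rootNumberThree_of_psRow : η(−1) = W₃`** (in `ℂ₃`) — the sign `η(−1)` of the
  route's analytic constant `κ = 9η(−1)/α²` (crux memo GZ3-NUMERIC-TEST-v3 §5, definition want D4)
  IS the local root number at `3`; and the value of the untwisted `3`-adic `L`-function at the trivial
  character reads **`𝓛(𝟙) = α⁻² · 9 W₃ · [0]⁺_{f_W}`** (`value_at_one_rootNumberThree`, composing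
  `CyclotomicUntwistValueAtOne.value_at_one`).
* §3 (the parity reading, any elliptic `W/ℚ`): the full-table local root number
  `W.fullTableLocalRootNumberAt` has finite multiplicative support
  (`hasFiniteMulSupport_fullTableLocalRootNumberAt`, from the tree's theorem `finite_badPlaces_holds`);
  granted the Modularity Theorem (`exists_isNewformOf`, giving `Even r_an ↔ w = 1`,
  `even_analyticRank_iff_rootNumber_eq_one_of_exists_isNewformOf`) and the table product formula
  (named fact `rootNumber_eq_neg_finprod_fullTableLocalRootNumberAt`, `w(E) = −∏_v w_v^{table}`):
  `Odd r_an ⟹ w(E) = −1 ⟹ ∏ᶠ_v w_v^{table} = 1 ⟹` **`∏ᶠ_{v ≠ v₃} w_v^{table} = W₃`**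
  (`finprod_ne_three_eq_rootNumberThree`); on the rank-one PS rows this is
  `= (−1)^{[v ≡ 2 (4)]}` (`+1` on Kodaira `II/II*`, `−1` on `IV/IV*`;
  `finprod_ne_three_eq_ite_of_psRow`) and `= η(−1)` for the matched untwisting character
  (`finprod_ne_three_eq_eta_neg_one_of_psRow`).

## Reading (informal; nothing of this is asserted)

For `π₃(f_E) = PS(χ, χ⁻¹)` one has `ε₃ = χ(−1)`; the route untwists by `η` with `η|_I = χ`, so
`η(−1) = χ(−1) = W₃(E)`: `+1` when `χ` has order `3` (`v ≡ 0 mod 4`), `−1` when it has order `6`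
(`v ≡ 2 mod 4`). §2 is this statement with the matching reduced to its order, which suffices because a
primitive character mod `9` is even iff its order is `3`. §3 says that on a RANK-ONE row the local signs
away from `3` multiply to `W₃` — e.g. on a `II`/`II*` row the number of places `v ≠ v₃` with
`w_v = −1` is even.

References: O. G. Rizzo, Compositio Math. 136 (2003) 1–23, §1 and Table II [Rizzo2003]; A. Kraus,
Manuscripta Math. 69 (1990) 353–385 [Kraus1990]; B. Mazur, J. Tate, J. Teitelbaum, Invent. Math. 84
(1986), §I.14 [MazurTateTeitelbaum1986Invent]; J. H. Silverman, *AEC* 2nd ed. (2009), C.16 Thm. 16.3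
[SilvermanAEC2009]; C. Breuil, B. Conrad, F. Diamond, R. Taylor, JAMS 14 (2001), Thm. A [BCDTJAMS2001];
L. C. Washington, *Introduction to Cyclotomic Fields*, GTM 83, Ch. 3 [Washington1997].
-/

open scoped Classical

open scoped MatrixGroups

open WeierstrassCurve IsDedekindDomain DirichletCharacter CongruenceSubgroup
  Literature.NumberTheory.EllipticCurves Literature.NumberTheory.EllipticCurves.ModularForms
  Literature.NumberTheory.EllipticCurves.Rank1Residual Literature.NumberTheory.IwasawaTheory
  Summit.BirchSwinnertonDyer.Rank1Residual.Additive
  Summit.BirchSwinnertonDyer.BirchSwinnertonDyer.Theorems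

-- single-conjunct summit: `Summit.BirchSwinnertonDyer.BirchSwinnertonDyer.…` repeats the name by design
set_option linter.dupNamespace false
set_option autoImplicit false

noncomputable section

namespace Summit.BirchSwinnertonDyer.BirchSwinnertonDyer.Theorems.PSUntwistingCharacterParity

/-! ### §1 Characters mod `9`: parity versus order -/

section Characters

variable (η : DirichletCharacter ℂ_[3] (3 ^ 2))

/-- `η(−1) = η(8) = η(2)³` (`−1 = 2³` in `ℤ/9`). [folklore] -/
theorem eta_neg_one_eq_pow_three : η (-1) = η 2 ^ 3 := by
  have h : (-1 : ZMod (3 ^ 2)) = 2 ^ 3 := by decide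
  rw [h, map_pow]

/-- `(η ^ n)(2) = η(2) ^ n` (`2` is a unit mod `9`). [folklore] -/
theorem pow_apply_two (n : ℕ) : (η ^ n) 2 = η 2 ^ n := by
  have h2 : ((ZMod.unitOfCoprime 2 (by decide) : (ZMod (3 ^ 2))ˣ) : ZMod (3 ^ 2)) = 2 := rfl
  rw [← h2, MulChar.pow_apply_coe]

/-- The unit `2` generates `(ℤ/9)^×` (it has order `6 = φ(9)`). [folklore] -/
theorem forall_mem_zpowers_two :
    ∀ x : (ZMod (3 ^ 2))ˣ, x ∈ Subgroup.zpowers (ZMod.unitOfCoprime 2 (by decide) : (ZMod (3 ^ 2))ˣ) := by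
  have hord : orderOf (ZMod.unitOfCoprime 2 (by decide) : (ZMod (3 ^ 2))ˣ) = 6 := by
    rw [orderOf_eq_iff (by norm_num)]
    refine ⟨by decide, fun m hm hm0 ↦ ?_⟩
    interval_cases m <;> decide
  have hcard : Nat.card (ZMod (3 ^ 2))ˣ = 6 := by
    rw [Nat.card_eq_fintype_card, ZMod.card_units_eq_totient]; decide
  have htop : Subgroup.zpowers (ZMod.unitOfCoprime 2 (by decide) : (ZMod (3 ^ 2))ˣ) = ⊤ :=
    Subgroup.eq_top_of_card_eq _ (by rw [Nat.card_zpowers, hord, hcard])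
  intro x
  rw [htop]
  exact Subgroup.mem_top x

/-- A character mod `9` is determined by its value at the generator `2` of `(ℤ/9)^×`
(cf. `PSLineCoefficients.eq_of_apply_two_eq` at modulus `9`; here at modulus `3 ^ 2`, D1's spelling).
[cite: Washington1997, Ch. 3 (characters mod pⁿ)] -/
theorem eq_of_apply_two_eq' (η' : DirichletCharacter ℂ_[3] (3 ^ 2)) (h : η 2 = η' 2) : η = η' := by
  set g : (ZMod (3 ^ 2))ˣ := ZMod.unitOfCoprime 2 (by decide) with hg
  have hug : MulChar.toUnitHom η g = MulChar.toUnitHom η' g := by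
    ext
    rw [MulChar.coe_toUnitHom, MulChar.coe_toUnitHom]
    exact h
  refine MulChar.ext fun a ↦ ?_
  obtain ⟨k, hk⟩ := Subgroup.mem_zpowers_iff.mp (forall_mem_zpowers_two a)
  rw [← hk, ← MulChar.coe_toUnitHom, ← MulChar.coe_toUnitHom, map_zpow, map_zpow, hug]

/-- The trivial character takes the value `1` at `2`. [folklore] -/
theorem one_apply_two : (1 : DirichletCharacter ℂ_[3] (3 ^ 2)) 2 = 1 := by
  have h2 : ((ZMod.unitOfCoprime 2 (by decide) : (ZMod (3 ^ 2))ˣ) : ZMod (3 ^ 2)) = 2 := rfl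
  rw [← h2, MulChar.one_apply_coe]

/-- `η ^ n = 1 ↔ η(2) ^ n = 1`. [folklore] -/
theorem pow_eq_one_iff_apply_two (n : ℕ) : η ^ n = 1 ↔ η 2 ^ n = 1 := by
  constructor
  · intro h
    rw [← pow_apply_two, h, one_apply_two]
  · intro h
    refine eq_of_apply_two_eq' (η ^ n) 1 ?_
    rw [pow_apply_two, h, one_apply_two]

/-- **The order of a character mod `9` is the order of its value at `2`.** [folklore] -/
theorem orderOf_eq_orderOf_apply_two : orderOf η = orderOf (η 2) :=
  orderOf_eq_orderOf_iff.mpr fun n ↦ pow_eq_one_iff_apply_two η n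

/-- `η(2)⁶ = 1`, so `η(−1)² = 1`: `η(−1) = 1 ∨ η(−1) = −1` for EVERY character mod `9` with values in
the field `ℂ₃`. [folklore] -/
theorem eta_neg_one_eq_one_or : η (-1) = 1 ∨ η (-1) = -1 := by
  obtain ⟨-, -, -, -, -, -, e6⟩ := CyclotomicUntwistValueAtOne.eta_table η
  have hsq : η (-1) * η (-1) = 1 := by rw [eta_neg_one_eq_pow_three, ← pow_add]; exact e6
  exact mul_self_eq_one_iff.mp hsq

/-- For `η` PRIMITIVE mod `9`: `η(2)³ = 1 ∨ η(2)³ = −1`, and in the first case `η(2) ≠ 1`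
(`η(4) = η(2)² ≠ 1`, `CyclotomicUntwistValueAtOne.eta_four_ne_one`). [folklore] -/
theorem apply_two_sq_ne_one (hη : η.IsPrimitive) : η 2 ^ 2 ≠ 1 := by
  obtain ⟨-, -, e4, -, -, -, -⟩ := CyclotomicUntwistValueAtOne.eta_table η
  rw [← e4]
  exact CyclotomicUntwistValueAtOne.eta_four_ne_one η hη

/-- For `η` primitive mod `9` and EVEN (`η(−1) = 1`): `η(2)` is a primitive cube root of unity, so
**`orderOf η = 3`**. [cite: Washington1997, Ch. 3] -/
theorem orderOf_eq_three_of_even (hη : η.IsPrimitive) (he : η (-1) = 1) : orderOf η = 3 := by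
  rw [orderOf_eq_orderOf_apply_two]
  rw [eta_neg_one_eq_pow_three] at he
  refine orderOf_eq_prime he fun h1 ↦ apply_two_sq_ne_one η hη ?_
  rw [h1, one_pow]

/-- For `η` primitive mod `9` and ODD (`η(−1) = −1`): `η(2)` is a primitive sixth root of unity, so
**`orderOf η = 6`**. [cite: Washington1997, Ch. 3] -/
theorem orderOf_eq_six_of_odd (hη : η.IsPrimitive) (ho : η (-1) = -1) : orderOf η = 6 := by
  rw [orderOf_eq_orderOf_apply_two]
  rw [eta_neg_one_eq_pow_three] at ho
  obtain ⟨-, -, -, -, -, -, e6⟩ := CyclotomicUntwistValueAtOne.eta_table η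
  have h2 := apply_two_sq_ne_one η hη
  have hm1 : (-1 : ℂ_[3]) ≠ 1 := by norm_num
  rw [orderOf_eq_iff (by norm_num)]
  refine ⟨e6, fun m hm hm0 hm1' ↦ ?_⟩
  interval_cases m
  · -- m = 1
    rw [pow_one] at hm1'
    exact h2 (by rw [hm1', one_pow])
  · exact h2 hm1'
  · exact hm1 (ho ▸ hm1')
  · -- z⁴ = 1 with z³ = −1 gives z = −1, hence z² = 1
    have hz : η 2 = -1 := by
      have : η 2 ^ 4 = η 2 ^ 3 * η 2 := by ring
      rw [this, ho] at hm1'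
      linear_combination -hm1'
    exact h2 (by rw [hz]; norm_num)
  · -- z⁵ = 1 with z⁶ = 1 gives z = 1
    have hz : η 2 = 1 := by
      have : η 2 ^ 6 = η 2 ^ 5 * η 2 := by ring
      rw [this, hm1', one_mul] at e6
      exact e6
    exact h2 (by rw [hz, one_pow])

/-- **A primitive character mod `9` has order `3` or `6`.** [cite: Washington1997, Ch. 3] -/
theorem orderOf_eq_three_or_six (hη : η.IsPrimitive) : orderOf η = 3 ∨ orderOf η = 6 := by
  rcases eta_neg_one_eq_one_or η with h | h
  · exact Or.inl (orderOf_eq_three_of_even η hη h)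
  · exact Or.inr (orderOf_eq_six_of_odd η hη h)

/-- **Parity versus order, even case**: a primitive `η` mod `9` is even iff it has order `3`.
[cite: Washington1997, Ch. 3] -/
theorem even_iff_orderOf_eq_three (hη : η.IsPrimitive) : η.Even ↔ orderOf η = 3 := by
  refine ⟨fun h ↦ orderOf_eq_three_of_even η hη h, fun h ↦ ?_⟩
  rcases eta_neg_one_eq_one_or η with he | ho
  · exact he
  · have := orderOf_eq_six_of_odd η hη ho; omega

/-- **Parity versus order, odd case**: a primitive `η` mod `9` is odd iff it has order `6`.
[cite: Washington1997, Ch. 3] -/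
theorem odd_iff_orderOf_eq_six (hη : η.IsPrimitive) : η.Odd ↔ orderOf η = 6 := by
  refine ⟨fun h ↦ orderOf_eq_six_of_odd η hη h, fun h ↦ ?_⟩
  rcases eta_neg_one_eq_one_or η with he | ho
  · have := orderOf_eq_three_of_even η hη he; omega
  · exact ho

/-- `η(−1)` from the order: `η(−1) = if orderOf η = 6 then −1 else 1` (primitive `η` mod `9`).
[cite: Washington1997, Ch. 3] -/
theorem eta_neg_one_eq_ite (hη : η.IsPrimitive) :
    η (-1) = if orderOf η = 6 then -1 else 1 := by
  rcases eta_neg_one_eq_one_or η with he | ho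
  · rw [he, if_neg]
    have := orderOf_eq_three_of_even η hη he
    omega
  · rw [ho, if_pos (orderOf_eq_six_of_odd η hη ho)]

end Characters

/-! ### §2 The bridge on the principal-series rows: `η(−1) = W₃` -/

section Curve

variable (W : WeierstrassCurve ℚ) [W.IsElliptic] [W.IsGloballyMinimal]
  (η : DirichletCharacter ℂ_[3] (3 ^ 2))

/-- **`η(−1) = W₃(E)` on the principal-series rows.** For `W/ℚ` globally minimal on a PS row
(`ClassO6 W 3`, `v₃(Δ_min)` even, `Δ_min/3^v ≡ 1 (mod 3)`) and `η` a primitive character mod `9`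
whose order is Kraus's inertia order of `W` at `3` (the route's matching `η|_I = χ`, read through
its order): `η(−1)` equals Rizzo's local root number `W₃` — `+1` on Kodaira `II/II*` (order `3`),
`−1` on `IV/IV*` (order `6`). Composes `PSRootNumberThree.rootNumberThree_of_psRow` /
`…_eq_neg_one_iff_krausInertiaOrderThree_of_psRow` with §1.
[cite: Rizzo2003, Table II (p. 4)] [cite: Kraus1990, Théorème (p = 3)] -/
theorem eta_neg_one_eq_rootNumberThree_of_psRow (hO6 : ClassO6 W 3)
    (hev : Even (padicValInt 3 W.minimalDiscriminantInt))
    (hps : W.minimalDiscriminantInt / 3 ^ padicValInt 3 W.minimalDiscriminantInt % 3 = 1)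
    (hη : η.IsPrimitive) (hmatch : orderOf η = krausInertiaOrderThree W) :
    η (-1) = (W.rootNumberThree : ℂ_[3]) := by
  have hiff := PSRootNumberThree.rootNumberThree_eq_neg_one_iff_krausInertiaOrderThree_of_psRow W hO6 hev hps
  have hform := PSRootNumberThree.rootNumberThree_of_psRow W hO6 hev hps
  rw [eta_neg_one_eq_ite η hη, hmatch]
  by_cases h6 : krausInertiaOrderThree W = 6
  · rw [if_pos h6, hiff.mpr h6]; norm_num
  · rw [if_neg h6]
    have hne : W.rootNumberThree ≠ -1 := fun h ↦ h6 (hiff.mp h)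
    rw [hform] at hne ⊢
    split_ifs with h
    · exact absurd (if_pos h) (by rwa [if_pos h] at hne)
    · norm_num

/-- **The value of the untwisted `3`-adic `L`-function at the trivial character, with the sign read
in Rizzo's table**: on a PS row, for `η` primitive mod `9` of order Kraus's inertia order, any `α` and
any `𝓛` with D1's property `IsPSCyclotomicLFunctionOf W η α 𝓛`:
`𝓛(𝟙) = 𝓛 0 0 = α⁻² · 9 · W₃ · [0]⁺_{f_W}` — the interpolation constant at `𝟙` is `9 W₃(E)/α²`
(`CyclotomicUntwistValueAtOne.value_at_one` with `η(−1) = W₃`).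
[cite: MazurTateTeitelbaum1986Invent, §I.14 (case p ∣ N, a_p ≠ 0)] [cite: Rizzo2003, Table II (p. 4)] -/
theorem value_at_one_rootNumberThree (hO6 : ClassO6 W 3)
    (hev : Even (padicValInt 3 W.minimalDiscriminantInt))
    (hps : W.minimalDiscriminantInt / 3 ^ padicValInt 3 W.minimalDiscriminantInt % 3 = 1)
    (hη : η.IsPrimitive) (hmatch : orderOf η = krausInertiaOrderThree W)
    (α : ℂ_[3]) (𝓛 : (n : ℕ) → ZMod (3 ^ n) → ℂ_[3]) (h : IsPSCyclotomicLFunctionOf W η α 𝓛) :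
    ∃ (N : ℕ) (_ : NeZero N) (f : CuspForm (Gamma0 N) 2), IsNewformOf W f ∧
      𝓛 0 0 = α⁻¹ ^ 2 * (9 * (W.rootNumberThree : ℂ_[3]) *
        algebraMap ℚ ℂ_[3] (ratPlusSymbol f 0)) := by
  obtain ⟨N, hN, f, hf, hval, -⟩ :=
    CyclotomicUntwistValueAtOne.value_at_one η α 𝓛 h hO6.2.1 hη
  refine ⟨N, hN, f, hf, ?_⟩
  rw [hval, eta_neg_one_eq_rootNumberThree_of_psRow W η hO6 hev hps hη hmatch]

end Curve

/-! ### §3 The rank-one parity reading: `∏_{v ≠ v₃} w_v^{table}(E) = W₃(E)` -/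

section Parity

open Summit.BirchSwinnertonDyer.BirchSwinnertonDyer.Rank2Observatory.RootNumber
  Rat.HeightOneSpectrum

variable (W : WeierstrassCurve ℚ) [W.IsElliptic]

/-- **The full-table local root number is `1` at all but finitely many places**: its multiplicative
support lies in the bad places (finite: the tree's theorem `finite_badPlaces_holds`) together with the
places above `2` and `3`. [cite: Rizzo2003, §1 Fact 3 (2)] -/
theorem hasFiniteMulSupport_fullTableLocalRootNumberAt :
    Function.HasFiniteMulSupport (fun v : HeightOneSpectrum ℤ ↦ W.fullTableLocalRootNumberAt v) := by
  have hfin : (Function.mulSupport fun v : HeightOneSpectrum ℤ ↦ W.localRootNumberAt v).Finite :=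
    mulSupport_localRootNumberAt_finite W (W.finite_badPlaces_holds ℤ)
  refine Set.Finite.subset ((hfin.union (Set.finite_singleton (natPlace 2))).union
    (Set.finite_singleton (natPlace 3))) fun v hv ↦ ?_
  rw [Function.mem_mulSupport] at hv
  by_cases h2 : ringChar (ℤ ⧸ v.asIdeal) = 2
  · left; right
    rw [Set.mem_singleton_iff, ← natPlace_natGenerator v, ← ringChar_quot_eq v, h2]
  by_cases h3 : ringChar (ℤ ⧸ v.asIdeal) = 3
  · right
    rw [Set.mem_singleton_iff, ← natPlace_natGenerator v, ← ringChar_quot_eq v, h3]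
  · left; left
    rw [Function.mem_mulSupport, ← fullTableLocalRootNumberAt_of_ringChar_ne h2 h3]
    exact hv

/-- **Odd analytic rank forces root number `−1`**, granted the Modularity Theorem (tree fact
`even_analyticRank_iff_rootNumber_eq_one_of_exists_isNewformOf`: `Even r_an ↔ w(E) = 1`; and
`w(E) = ±1`, `rootNumber_eq_one_or`). [cite: SilvermanAEC2009, C.16 Thm. 16.3 and remark, p. 451]
[cite: BCDTJAMS2001, Thm. A] -/
theorem rootNumber_eq_neg_one_of_odd_analyticRank (hmod : exists_isNewformOf)
    (hodd : Odd W.analyticRank) : W.rootNumber = -1 := by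
  have h : Even W.analyticRank ↔ W.rootNumber = 1 :=
    even_analyticRank_iff_rootNumber_eq_one_of_exists_isNewformOf W hmod
  rcases W.rootNumber_eq_one_or with h1 | h1
  · exact absurd (h.mpr h1) (Nat.not_even_iff_odd.mpr hodd)
  · exact h1

/-- On a curve of odd analytic rank the full-table local root numbers multiply to `+1`
(`w(E) = −1 = −∏_v w_v^{table}`), granted modularity and the table product formula (named fact
`rootNumber_eq_neg_finprod_fullTableLocalRootNumberAt`). [cite: Rizzo2003, §1 (p. 2), Fact 3] -/
theorem finprod_fullTableLocalRootNumberAt_eq_one (hmod : exists_isNewformOf)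
    (hR : W.rootNumber_eq_neg_finprod_fullTableLocalRootNumberAt) (hodd : Odd W.analyticRank) :
    ∏ᶠ v : HeightOneSpectrum ℤ, W.fullTableLocalRootNumberAt v = 1 := by
  have h1 := rootNumber_eq_neg_one_of_odd_analyticRank W hmod hodd
  have h2 : W.rootNumber = -∏ᶠ v : HeightOneSpectrum ℤ, W.fullTableLocalRootNumberAt v := hR
  linarith

/-- **The rank-odd parity reading at `3`.** For an elliptic `W/ℚ` of ODD analytic rank and the place
`v₃` above `3`: the product of the full-table local root numbers over the finite places `v ≠ v₃`
equals Rizzo's `W₃ = W.rootNumberThree` — granted modularity and the table product formula.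
(`w_∞ = −1` is built into the named fact; `W₃ · ∏_{v ≠ v₃} w_v = 1` in `ℤ` forces both factors to be
the same sign.) [cite: Rizzo2003, §1 (p. 2), Fact 3 and Table II (p. 4)] -/
theorem finprod_ne_three_eq_rootNumberThree (hmod : exists_isNewformOf)
    (hR : W.rootNumber_eq_neg_finprod_fullTableLocalRootNumberAt) (hodd : Odd W.analyticRank)
    {v₃ : HeightOneSpectrum ℤ} (hv₃ : ringChar (ℤ ⧸ v₃.asIdeal) = 3) :
    ∏ᶠ (v : HeightOneSpectrum ℤ) (_ : v ≠ v₃), W.fullTableLocalRootNumberAt v = W.rootNumberThree := by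
  have hsplit := mul_finprod_cond_ne (f := fun v : HeightOneSpectrum ℤ ↦ W.fullTableLocalRootNumberAt v)
    v₃ (hasFiniteMulSupport_fullTableLocalRootNumberAt W)
  rw [finprod_fullTableLocalRootNumberAt_eq_one W hmod hR hodd,
    fullTableLocalRootNumberAt_of_ringChar_eq_three hv₃] at hsplit
  exact (Int.eq_of_mul_eq_one hsplit).symm

/-- The place of `3` qualifies: `ringChar (ℤ ⧸ (natPlace 3)) = 3`. [folklore] -/
theorem ringChar_natPlace_three : ringChar (ℤ ⧸ (natPlace 3).asIdeal) = 3 := by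
  rw [ringChar_quot_eq, natGenerator_natPlace Nat.prime_three]

variable [W.IsGloballyMinimal]

/-- **The parity reading on the rank-one principal-series rows of K1/K2**: for `W/ℚ` globally minimal
with `ClassO6 W 3`, `v₃(Δ_min)` even, `Δ_min/3^v ≡ 1 (mod 3)` and ODD analytic rank (e.g. `r_an = 1`):
`∏_{v ≠ v₃} w_v^{table} = −1` if `v ≡ 2 (mod 4)` (Kodaira `IV/IV*`) and `= +1` otherwise (`II/II*`)
— granted modularity and the table product formula. [cite: Rizzo2003, §1 Fact 3 and Table II (p. 4)] -/
theorem finprod_ne_three_eq_ite_of_psRow (hmod : exists_isNewformOf)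
    (hR : W.rootNumber_eq_neg_finprod_fullTableLocalRootNumberAt) (hO6 : ClassO6 W 3)
    (hev : Even (padicValInt 3 W.minimalDiscriminantInt))
    (hps : W.minimalDiscriminantInt / 3 ^ padicValInt 3 W.minimalDiscriminantInt % 3 = 1)
    (hodd : Odd W.analyticRank) {v₃ : HeightOneSpectrum ℤ} (hv₃ : ringChar (ℤ ⧸ v₃.asIdeal) = 3) :
    ∏ᶠ (v : HeightOneSpectrum ℤ) (_ : v ≠ v₃), W.fullTableLocalRootNumberAt v =
      if padicValInt 3 W.minimalDiscriminantInt % 4 = 2 then -1 else 1 := by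
  rw [finprod_ne_three_eq_rootNumberThree W hmod hR hodd hv₃,
    PSRootNumberThree.rootNumberThree_of_psRow W hO6 hev hps]

/-- **The parity reading at the untwisting character**: on a rank-odd PS row, for `η` primitive mod `9`
of order Kraus's inertia order, `∏_{v ≠ v₃} w_v^{table}(E) = η(−1)` in `ℂ₃` — granted modularity and
the table product formula. [cite: Rizzo2003, §1 Fact 3 and Table II (p. 4)] [cite: Kraus1990, Théorème (p = 3)] -/
theorem finprod_ne_three_eq_eta_neg_one_of_psRow (hmod : exists_isNewformOf)
    (hR : W.rootNumber_eq_neg_finprod_fullTableLocalRootNumberAt) (hO6 : ClassO6 W 3)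
    (hev : Even (padicValInt 3 W.minimalDiscriminantInt))
    (hps : W.minimalDiscriminantInt / 3 ^ padicValInt 3 W.minimalDiscriminantInt % 3 = 1)
    (hodd : Odd W.analyticRank) {v₃ : HeightOneSpectrum ℤ} (hv₃ : ringChar (ℤ ⧸ v₃.asIdeal) = 3)
    (η : DirichletCharacter ℂ_[3] (3 ^ 2)) (hη : η.IsPrimitive)
    (hmatch : orderOf η = krausInertiaOrderThree W) :
    ((∏ᶠ (v : HeightOneSpectrum ℤ) (_ : v ≠ v₃), W.fullTableLocalRootNumberAt v : ℤ) : ℂ_[3]) = η (-1) := by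
  rw [finprod_ne_three_eq_rootNumberThree W hmod hR hodd hv₃,
    eta_neg_one_eq_rootNumberThree_of_psRow W η hO6 hev hps hη hmatch]

end Parity

end Summit.BirchSwinnertonDyer.BirchSwinnertonDyer.Theorems.PSUntwistingCharacterParity

end
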